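import Mathlib
import Literature.Analysis.FluidPDE.Tao2016AveragedNS.ShiftSetCascadeFlows
import Summits.NavierStokesRegularity.NavierStokesRegularity.Theorems.TaoLadderRungTwoFlatCertificateGlueCheckerFieldArrayOn
import Summits.NavierStokesRegularity.NavierStokesRegularity.Theorems.TaoLadderRungTwoFlatCertificateGlueJacobianRowsOn
import HarnessLib

/-!
# Certificate glue on a shift set `𝕊`, XXXVIII-b: THE SPARSE INTERVAL JACOBIAN OF THE WINDOW FIELD — `termJac`, `jacRowRaw`, `pqJacA` and the
  soundness interface `IsJacEnclosureA` with its instance `isJacEnclosureA_pqJacA` (helper for items stmt-NavierStokesRegularity-22987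
  `FlatGapCertificatesV2` (crux K_A♭ of route TaoLadderRungTwoFlat) and stmt-24295 K_A₂(64); cell harvest/h2-tao-ladder, p1 g18; PERFORMANCE refactor
  of the step checker)

For a state box `A` (coordinates of `x`), row `d ↔ (i, k)` of `pqJacA … A` is a SPARSE INTERVAL ROW (glue XXXVIII-a) enclosing the linear functional
`v ↦ (PQcN x v + PQcN v x)_d` — the `d`-th row of the Jacobian of the quadratic window field at `x`: each monomial `(i₁, i₂, μ)` contributes
`coefB · X(idx(i₁,a))` at column `idx(i₂,b)` and `coefB · X(idx(i₂,b))` at column `idx(i₁,a)`; equal columns are MERGED (`mergeRow`), so for `S♭`,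
`m = 2` a row has at most `6` entries instead of `56`. `IsJacEnclosureA Q Jf` is the abstract statement (a decorated row with real witnesses exists
for every `x ∈ A`), consumed by the matrix recursion of glue XXXVIII-c.

HONEST FRAMING: Tao-type MODEL lattices (Tao 2016 §4/§6 vocabulary, shift-set parametrised); interval-arithmetic soundness about an explicit polynomial
field — no certificate data, nothing certified, no stub closed, nothing here is a statement about the Navier–Stokes equations.
-/

-- the sub-problem namespace repeats the summit name by design (D-0017)
set_option linter.dupNamespace false

namespace Summit.NavierStokesRegularity.NavierStokesRegularity.Theorems

open Set Finset Literature.Analysis.FluidPDE Literature.Analysis.FluidPDE.TaoCascade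
open Summit.NavierStokesRegularity.NavierStokesRegularity.Theorems.TaylorModelCert
open Summit.NavierStokesRegularity.NavierStokesRegularity.Theorems.TaylorModelReadout

namespace CertificateGlueOn

variable {m : ℕ} {Kb Ka : ℤ} {ω : Fin m → ℤ → ℝ}

/-! ### Readers of row tables -/

/-- Row `c` of a row table (junk `[]` beyond the size). [folklore] -/
def rget (R : Array (List (ℕ × IntervalD))) (c : ℕ) : List (ℕ × IntervalD) := if h : c < R.size then R[c] else []

/-- `rget` of `Array.ofFn`. [folklore] -/
theorem rget_ofFn {n : ℕ} (f : Fin n → List (ℕ × IntervalD)) {c : ℕ} (hc : c < n) : rget (Array.ofFn f) c = f ⟨c, hc⟩ := by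
  unfold rget
  rw [dif_pos (by rw [Array.size_ofFn]; exact hc), Array.getElem_ofFn]

/-! ### The abstract interface -/

/-- **A SPARSE INTERVAL JACOBIAN OF A QUADRATIC FIELD**: for every state box `A` and every `x` with coordinates in `A`, every row `c` of `Jf A` is the
projection of a decorated row (witnesses in their boxes, indices `< n`) whose functional is `v ↦ (Q x v + Q v x)_c`. [folklore] -/
def IsJacEnclosureA {n : ℕ} (Q : (Fin n → ℝ) → (Fin n → ℝ) → Fin n → ℝ) (Jf : Array IntervalD → Array (List (ℕ × IntervalD))) : Prop :=
  ∀ (A : Array IntervalD) (x : Fin n → ℝ), (∀ c < n, IntervalD.mem (rdN x c) (IntervalD.aget A c)) → ∀ c : Fin n,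
    ∃ σ : List (ℕ × ℝ × IntervalD), OkRow σ ∧ projRow σ = rget (Jf A) c ∧ (∀ t ∈ σ, t.1 < n) ∧
      ∀ v : Fin n → ℝ, Q x v c + Q v x c = valRow σ (rdN v)

/-! ### The sparse Jacobian of the window field: the executable side -/

/-- The two Jacobian entries of the monomial `(i₁, i₂, μ)` of target `(i, k)` at the state box `X`: `(idx(i₂,b), coefB·X(idx(i₁,a)))` (the slot
of the second argument) and `(idx(i₁,a), coefB·X(idx(i₂,b)))` (the slot of the first); none if a factor is off the window. [folklore] -/
def termJac (Kb Ka : ℤ) (prec : ℕ) (coefB : Fin m → ℤ → Fin m → Fin m → ℤ × ℤ × ℤ → IntervalD)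
    (X : Fin (m * winLen Kb Ka) → IntervalD) (i : Fin m) (k : ℤ) (i₁ i₂ : Fin m) (μ : ℤ × ℤ × ℤ) : List (ℕ × IntervalD) :=
  if ha : -Kb ≤ k - μ.2.2 + μ.1 ∧ k - μ.2.2 + μ.1 ≤ Ka then
    if hb : -Kb ≤ k - μ.2.2 + μ.2.1 ∧ k - μ.2.2 + μ.2.1 ≤ Ka then
      [((idxOf Kb Ka i₂ (k - μ.2.2 + μ.2.1) hb : ℕ), IntervalD.mulR prec (coefB i k i₁ i₂ μ) (X (idxOf Kb Ka i₁ (k - μ.2.2 + μ.1) ha))),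
        ((idxOf Kb Ka i₁ (k - μ.2.2 + μ.1) ha : ℕ), IntervalD.mulR prec (coefB i k i₁ i₂ μ) (X (idxOf Kb Ka i₂ (k - μ.2.2 + μ.2.1) hb)))]
    else []
  else []

/-- The raw (unmerged) Jacobian row of target `d ↔ (i, k)`: all monomial entries over `(i₁, i₂, μ) ∈ Fin m × Fin m × shifts`. [folklore] -/
def jacRowRaw (Kb Ka : ℤ) (prec : ℕ) (shifts : List (ℤ × ℤ × ℤ)) (coefB : Fin m → ℤ → Fin m → Fin m → ℤ × ℤ × ℤ → IntervalD)
    (X : Fin (m * winLen Kb Ka) → IntervalD) (d : Fin (m * winLen Kb Ka)) : List (ℕ × IntervalD) :=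
  (List.finRange m).flatMap fun i₁ => (List.finRange m).flatMap fun i₂ => shifts.flatMap fun μ =>
    termJac Kb Ka prec coefB X (finProdFinEquiv.symm d).1 (shellAt Kb (finProdFinEquiv.symm d).2) i₁ i₂ μ

/-- **THE SPARSE INTERVAL JACOBIAN OF THE WINDOW FIELD** at the state box `A`: row `d` = the merged monomial entries.
[cite: Tao2016AveragedNS, §4 (4.8); cell certificate format, checker field] -/
def pqJacA (Kb Ka : ℤ) (prec : ℕ) (shifts : List (ℤ × ℤ × ℤ)) (coefB : Fin m → ℤ → Fin m → Fin m → ℤ × ℤ × ℤ → IntervalD)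
    (A : Array IntervalD) : Array (List (ℕ × IntervalD)) :=
  Array.ofFn fun d : Fin (m * winLen Kb Ka) => mergeRow prec (jacRowRaw Kb Ka prec shifts coefB (fun d' => IntervalD.aget A d') d)

/-! ### Decorated rows over `flatMap` -/

/-- `projRow` commutes with `flatMap`. [folklore] -/
theorem projRow_flatMap {τ : Type*} (f : τ → List (ℕ × ℝ × IntervalD)) :
    ∀ l : List τ, projRow (l.flatMap f) = l.flatMap fun a => projRow (f a)
  | [] => rfl
  | a :: l => by rw [List.flatMap_cons, List.flatMap_cons, projRow_append, projRow_flatMap f l]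

/-- `valRow` of a `flatMap` is the sum of the values. [folklore] -/
theorem valRow_flatMap {τ : Type*} (f : τ → List (ℕ × ℝ × IntervalD)) (v : ℕ → ℝ) :
    ∀ l : List τ, valRow (l.flatMap f) v = (l.map fun a => valRow (f a) v).sum
  | [] => by simp
  | a :: l => by rw [List.flatMap_cons, valRow_append, valRow_flatMap f v l, List.map_cons, List.sum_cons]

/-- `OkRow` of a `flatMap`. [folklore] -/
theorem okRow_flatMap {τ : Type*} {f : τ → List (ℕ × ℝ × IntervalD)} {l : List τ} (h : ∀ a ∈ l, OkRow (f a)) : OkRow (l.flatMap f) := by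
  intro t ht
  obtain ⟨a, ha, hta⟩ := List.mem_flatMap.1 ht
  exact h a ha t hta

/-- Index bound of a `flatMap`. [folklore] -/
theorem bound_flatMap {τ : Type*} {n : ℕ} {f : τ → List (ℕ × ℝ × IntervalD)} {l : List τ} (h : ∀ a ∈ l, ∀ t ∈ f a, t.1 < n) :
    ∀ t ∈ l.flatMap f, t.1 < n := by
  intro t ht
  obtain ⟨a, ha, hta⟩ := List.mem_flatMap.1 ht
  exact h a ha t hta

/-! ### The decorated Jacobian row and its functional -/

variable {ε₀ : ℝ} {α : Fin m → Fin m → Fin m → ℤ × ℤ × ℤ → ℝ}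
  {shifts : List (ℤ × ℤ × ℤ)} {prec : ℕ} {coefB : Fin m → ℤ → Fin m → Fin m → ℤ × ℤ × ℤ → IntervalD}

/-- The monomial `(i₁, i₂, μ)` of target `(i, k)` of the window field, divided by the target weight (the summand of `PQcN`). [folklore] -/
noncomputable def pterm (ε₀ : ℝ) (α : Fin m → Fin m → Fin m → ℤ × ℤ × ℤ → ℝ) (Kb Ka : ℤ) (ω : Fin m → ℤ → ℝ)
    (x y : Fin (m * winLen Kb Ka) → ℝ) (i : Fin m) (k : ℤ) (i₁ i₂ : Fin m) (μ : ℤ × ℤ × ℤ) : ℝ :=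
  α i₁ i₂ i μ * (1 + ε₀) ^ ((5 : ℝ) * (k - μ.2.2) / 2) *
    (truncAt Kb Ka (pwstate Kb Ka ω (x ∘ finProdFinEquiv)) i₁ (k - μ.2.2 + μ.1) *
      truncAt Kb Ka (pwstate Kb Ka ω (y ∘ finProdFinEquiv)) i₂ (k - μ.2.2 + μ.2.1)) / ω i k

/-- **The window field as a sum of monomials** (list form over `shifts`). [cite: Tao2016AveragedNS, §4 (4.8); cell certificate format, checker field] -/
theorem PQcN_eq_sum_pterm (hnd : shifts.Nodup) (x y : Fin (m * winLen Kb Ka) → ℝ) (d : Fin (m * winLen Kb Ka)) :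
    PQcN shifts.toFinset ε₀ α Kb Ka ω x y d =
      ∑ i₁ : Fin m, ∑ i₂ : Fin m, (shifts.map fun μ =>
        pterm ε₀ α Kb Ka ω x y (finProdFinEquiv.symm d).1 (shellAt Kb (finProdFinEquiv.symm d).2) i₁ i₂ μ).sum := by
  simp only [PQcN, PQc, pwcoord, biFieldOn, pterm]
  rw [Finset.sum_div]
  refine Finset.sum_congr rfl fun i₁ _ => ?_
  rw [Finset.sum_div]
  refine Finset.sum_congr rfl fun i₂ _ => ?_
  rw [Finset.sum_div, List.sum_toFinset _ hnd]

/-- The decorated twin of `termJac`: the real witnesses `pcoef · x(idx a)` and `pcoef · x(idx b)`. [folklore] -/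
noncomputable def termJacD (Kb Ka : ℤ) (prec : ℕ) (coefB : Fin m → ℤ → Fin m → Fin m → ℤ × ℤ × ℤ → IntervalD) (ε₀ : ℝ)
    (α : Fin m → Fin m → Fin m → ℤ × ℤ × ℤ → ℝ) (ω : Fin m → ℤ → ℝ) (x : Fin (m * winLen Kb Ka) → ℝ)
    (X : Fin (m * winLen Kb Ka) → IntervalD) (i : Fin m) (k : ℤ) (i₁ i₂ : Fin m) (μ : ℤ × ℤ × ℤ) : List (ℕ × ℝ × IntervalD) :=
  if ha : -Kb ≤ k - μ.2.2 + μ.1 ∧ k - μ.2.2 + μ.1 ≤ Ka then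
    if hb : -Kb ≤ k - μ.2.2 + μ.2.1 ∧ k - μ.2.2 + μ.2.1 ≤ Ka then
      [((idxOf Kb Ka i₂ (k - μ.2.2 + μ.2.1) hb : ℕ), pcoef ε₀ α ω i k i₁ i₂ μ * x (idxOf Kb Ka i₁ (k - μ.2.2 + μ.1) ha),
          IntervalD.mulR prec (coefB i k i₁ i₂ μ) (X (idxOf Kb Ka i₁ (k - μ.2.2 + μ.1) ha))),
        ((idxOf Kb Ka i₁ (k - μ.2.2 + μ.1) ha : ℕ), pcoef ε₀ α ω i k i₁ i₂ μ * x (idxOf Kb Ka i₂ (k - μ.2.2 + μ.2.1) hb),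
          IntervalD.mulR prec (coefB i k i₁ i₂ μ) (X (idxOf Kb Ka i₂ (k - μ.2.2 + μ.2.1) hb)))]
    else []
  else []

/-- Forgetting the witnesses gives `termJac`. [folklore] -/
theorem projRow_termJacD (x : Fin (m * winLen Kb Ka) → ℝ) (X : Fin (m * winLen Kb Ka) → IntervalD) (i : Fin m) (k : ℤ) (i₁ i₂ : Fin m)
    (μ : ℤ × ℤ × ℤ) : projRow (termJacD Kb Ka prec coefB ε₀ α ω x X i k i₁ i₂ μ) = termJac Kb Ka prec coefB X i k i₁ i₂ μ := by
  unfold termJacD termJac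
  split_ifs <;> rfl

/-- The witnesses of `termJacD` lie in their boxes (sound coefficient boxes, `x ∈ X`). [folklore] -/
theorem okRow_termJacD (hcoef : CoefBoxOK shifts ε₀ α Kb Ka ω coefB) {x : Fin (m * winLen Kb Ka) → ℝ} {X : Fin (m * winLen Kb Ka) → IntervalD}
    (hx : ∀ d, IntervalD.mem (x d) (X d)) (i : Fin m) {k : ℤ} (hk1 : -Kb ≤ k) (hk2 : k ≤ Ka) (i₁ i₂ : Fin m) {μ : ℤ × ℤ × ℤ} (hμ : μ ∈ shifts) :
    OkRow (termJacD Kb Ka prec coefB ε₀ α ω x X i k i₁ i₂ μ) := by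
  unfold termJacD
  split_ifs with ha hb
  · exact okRow_cons (IntervalD.mem_mulR prec (hcoef i k i₁ i₂ μ hμ hk1 hk2) (hx _))
      (okRow_cons (IntervalD.mem_mulR prec (hcoef i k i₁ i₂ μ hμ hk1 hk2) (hx _)) fun t ht => by simp at ht)
  · intro t ht; simp at ht
  · intro t ht; simp at ht

/-- The indices of `termJacD` are window indices. [folklore] -/
theorem bound_termJacD (x : Fin (m * winLen Kb Ka) → ℝ) (X : Fin (m * winLen Kb Ka) → IntervalD) (i : Fin m) (k : ℤ) (i₁ i₂ : Fin m)
    (μ : ℤ × ℤ × ℤ) : ∀ t ∈ termJacD Kb Ka prec coefB ε₀ α ω x X i k i₁ i₂ μ, t.1 < m * winLen Kb Ka := by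
  unfold termJacD
  split_ifs with ha hb
  · intro t ht
    simp only [List.mem_cons, List.mem_nil_iff, or_false] at ht
    rcases ht with rfl | rfl
    · exact (idxOf Kb Ka i₂ _ hb).isLt
    · exact (idxOf Kb Ka i₁ _ ha).isLt
  · intro t ht; simp at ht
  · intro t ht; simp at ht

/-- **The functional of `termJacD` is the symmetrised monomial** `pterm x v + pterm v x`. [folklore] -/
theorem valRow_termJacD (x : Fin (m * winLen Kb Ka) → ℝ) (X : Fin (m * winLen Kb Ka) → IntervalD) (i : Fin m) (k : ℤ) (i₁ i₂ : Fin m)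
    (μ : ℤ × ℤ × ℤ) (v : Fin (m * winLen Kb Ka) → ℝ) :
    valRow (termJacD Kb Ka prec coefB ε₀ α ω x X i k i₁ i₂ μ) (rdN v) = pterm ε₀ α Kb Ka ω x v i k i₁ i₂ μ + pterm ε₀ α Kb Ka ω v x i k i₁ i₂ μ := by
  unfold termJacD pterm
  by_cases ha : -Kb ≤ k - μ.2.2 + μ.1 ∧ k - μ.2.2 + μ.1 ≤ Ka
  · by_cases hb : -Kb ≤ k - μ.2.2 + μ.2.1 ∧ k - μ.2.2 + μ.2.1 ≤ Ka
    · rw [dif_pos ha, dif_pos hb, valRow_cons, valRow_cons, valRow_nil, rdN_of_lt _ (idxOf Kb Ka i₂ _ hb).isLt,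
        rdN_of_lt _ (idxOf Kb Ka i₁ _ ha).isLt, truncAt_pwstate_of_mem x i₁ ha, truncAt_pwstate_of_mem v i₂ hb, truncAt_pwstate_of_mem v i₁ ha,
        truncAt_pwstate_of_mem x i₂ hb]
      unfold pcoef
      simp only [Fin.eta]
      ring
    · rw [dif_pos ha, dif_neg hb, valRow_nil, truncAt_pwstate_of_not v i₂ hb, truncAt_pwstate_of_not x i₂ hb]
      ring
  · rw [dif_neg ha, valRow_nil, truncAt_pwstate_of_not x i₁ ha, truncAt_pwstate_of_not v i₁ ha]
    ring

/-- The decorated raw row. [folklore] -/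
noncomputable def jacRowRawD (Kb Ka : ℤ) (prec : ℕ) (shifts : List (ℤ × ℤ × ℤ)) (coefB : Fin m → ℤ → Fin m → Fin m → ℤ × ℤ × ℤ → IntervalD)
    (ε₀ : ℝ) (α : Fin m → Fin m → Fin m → ℤ × ℤ × ℤ → ℝ) (ω : Fin m → ℤ → ℝ) (x : Fin (m * winLen Kb Ka) → ℝ)
    (X : Fin (m * winLen Kb Ka) → IntervalD) (d : Fin (m * winLen Kb Ka)) : List (ℕ × ℝ × IntervalD) :=
  (List.finRange m).flatMap fun i₁ => (List.finRange m).flatMap fun i₂ => shifts.flatMap fun μ =>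
    termJacD Kb Ka prec coefB ε₀ α ω x X (finProdFinEquiv.symm d).1 (shellAt Kb (finProdFinEquiv.symm d).2) i₁ i₂ μ

/-- Forgetting the witnesses gives `jacRowRaw`. [folklore] -/
theorem projRow_jacRowRawD (x : Fin (m * winLen Kb Ka) → ℝ) (X : Fin (m * winLen Kb Ka) → IntervalD) (d : Fin (m * winLen Kb Ka)) :
    projRow (jacRowRawD Kb Ka prec shifts coefB ε₀ α ω x X d) = jacRowRaw Kb Ka prec shifts coefB X d := by
  unfold jacRowRawD jacRowRaw
  rw [projRow_flatMap]
  refine List.flatMap_congr fun i₁ _ => ?_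
  rw [projRow_flatMap]
  refine List.flatMap_congr fun i₂ _ => ?_
  rw [projRow_flatMap]
  exact List.flatMap_congr fun μ _ => projRow_termJacD x X _ _ i₁ i₂ μ

/-- **The functional of the decorated raw row is the Jacobian row** `v ↦ (PQcN x v + PQcN v x)_d`.
[cite: Tao2016AveragedNS, §4 (4.8); cell certificate format, checker field] -/
theorem valRow_jacRowRawD (hnd : shifts.Nodup) (x : Fin (m * winLen Kb Ka) → ℝ) (X : Fin (m * winLen Kb Ka) → IntervalD)
    (d : Fin (m * winLen Kb Ka)) (v : Fin (m * winLen Kb Ka) → ℝ) :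
    PQcN shifts.toFinset ε₀ α Kb Ka ω x v d + PQcN shifts.toFinset ε₀ α Kb Ka ω v x d =
      valRow (jacRowRawD Kb Ka prec shifts coefB ε₀ α ω x X d) (rdN v) := by
  rw [PQcN_eq_sum_pterm hnd, PQcN_eq_sum_pterm hnd, ← Finset.sum_add_distrib]
  unfold jacRowRawD
  rw [valRow_flatMap, ← Fin.sum_univ_def]
  refine Finset.sum_congr rfl fun i₁ _ => ?_
  rw [← Finset.sum_add_distrib, valRow_flatMap, ← Fin.sum_univ_def]
  refine Finset.sum_congr rfl fun i₂ _ => ?_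
  rw [valRow_flatMap, ← List.sum_map_add]
  exact congrArg List.sum (List.map_congr_left fun μ _ => (valRow_termJacD x X _ _ i₁ i₂ μ v).symm)

/-- **`pqJacA` IS A SPARSE INTERVAL JACOBIAN OF THE WINDOW FIELD** (`𝕊 = shifts.toFinset`, no duplicates, sound coefficient boxes).
[cite: Tao2016AveragedNS, §4 (4.8); cell certificate format, checker field] -/
theorem isJacEnclosureA_pqJacA (hKb : 0 ≤ Kb) (hKa : 1 ≤ Ka) (hnd : shifts.Nodup) (hcoef : CoefBoxOK shifts ε₀ α Kb Ka ω coefB) :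
    IsJacEnclosureA (PQcN shifts.toFinset ε₀ α Kb Ka ω) (pqJacA Kb Ka prec shifts coefB) := by
  intro A x hx d
  have hKK : 0 ≤ Ka + Kb + 1 := by omega
  obtain ⟨hk1, hk2⟩ := shellAt_mem hKK (finProdFinEquiv.symm d).2
  have hx' : ∀ d', IntervalD.mem (x d') (IntervalD.aget A d') := fun d' => by
    have := hx d' d'.isLt; rwa [rdN_of_lt _ d'.isLt] at this
  refine ⟨mergeRowD prec (jacRowRawD Kb Ka prec shifts coefB ε₀ α ω x (fun d' => IntervalD.aget A d') d), ?_, ?_, ?_, ?_⟩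
  · refine okRow_mergeRowD prec (okRow_flatMap fun i₁ _ => okRow_flatMap fun i₂ _ => okRow_flatMap fun μ hμ => ?_)
    exact okRow_termJacD hcoef hx' _ hk1 hk2 i₁ i₂ hμ
  · unfold pqJacA
    rw [rget_ofFn _ d.isLt, projRow_mergeRowD, projRow_jacRowRawD]
  · exact bound_mergeRowD prec (bound_flatMap fun i₁ _ => bound_flatMap fun i₂ _ => bound_flatMap fun μ _ => bound_termJacD x _ _ _ i₁ i₂ μ)
  · intro v
    rw [valRow_mergeRowD]
    exact valRow_jacRowRawD hnd x _ d v

end CertificateGlueOn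

end Summit.NavierStokesRegularity.NavierStokesRegularity.Theorems
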